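import Summits.QuantumFields.YangMills.Theorems.UnitScaleTiltProp7BondAvgIterCoercivity
import HarnessLib

/-!
# Route `UnitScaleTilt`, crux K1 child «MinimiserStabilityRegPr» (stmt-QuantumFields-19200), registered stub `stub_prop7From14` (skeleton birth_v5
# 98cb23610ad7; leaf V3 «Prop 7 from a background (14)») — sub-lemma V3-C (linear core), part 1/3: THE STRAIGHT-LINE `k`-FOLD BLOCK AVERAGE
# `M_k` ON TWO BLOCKS (tent weights), ITS TRANSPOSE-TYPE TENT-INTERPOLATION FIELD, AND THE TRIDIAGONAL NORMAL OPERATOR `M_k M_k^†`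

Cell `ym3-torus` ∕ fleet seat `ym-ust-19200-p1` (gen 3; HUMAN RULING D-0037, YM ladder rung R3).  WHERE THIS SITS.  [Balaban1985Variational] proves
Prop. 7 (p. 299) through the chart `A = A′ − HD(A′)` of Sect. C ((47) p. 285), whose linear core is a RIGHT INVERSE `H` of the linearised averaging:
«L^jη Q_j H B = B on Λ_j, R D^*HB = 0 (45) … |HB| ≤ B₀(L^jη)⁻¹|B|, |∇HB| ≤ B₀(L^jη)⁻²|B| (46)», the bound `B₀` being uniform in the number of
averaging levels `k`; print takes the `G`-weighted right inverse of [Balaban1984PropagatorsI] (3.126) and remarks (p. 287) «there are many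
linearizing transformations … Our choice h = H is a convenient one … but it is by no means a unique choice».  For the route's d = 3 carrier the main
term of the linearised `k`-fold averaging at `U = 1` is the straight-line block average `M_k` = `LatticeFieldCalculus.bondAvgIter k` of record
([Balaban1984PropagatorsI] (1.18), tree `Prop7FlatCoercivity.bondAvgIter_eq_lineBlockAvg`, p454029).  This file and its two sequels
(`…LineAvgTridiagonal`, `…LineAvgRightInverse`) construct the SIMPLEST `k`-uniform right inverse of `M_k` — tent interpolation composed with the
inverse of the tridiagonal normal operator — with sup, `ℓ¹` and `ℓ²` bounds whose constants (3, 6L^{kd}, 18L^{kd}) do not depend on `k` or on the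
volume (brick (ii) of the item's evidence #35 `evidence-D1c-linearisation.md`; the far-face right inverse of the tree, `B5AveragingOnto.bondLift`,
has sup norm `L^k`).

WHAT IS PROVED HERE (sorry-free, no definition; elementary — [folklore] ∕ cited to the printed formula it unfolds).  `n = L^k`, fine torus
`T^{(0)}`, coarse torus `T^{(k)}`, `h : |T^{(0)}| = L^k·|T^{(k)}|` per direction (standing range).
* §1 counting along a straight contour: `Σ_{s<n}Σ_{t<n} g(s+t) = Σ_{j<n}(j+1)•g(j) + Σ_{j<n}(n−1−j)•g(n+j)` (`sum_sum_range_add_eq`).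
* §2 offsets inside a `k`-block with one direction `μ` singled out (`sum_offsets_eq_sum_split`, `sum_offsets_comp_eval`:
  `Σ_r f(r_μ) = (L^k)^{d−1}Σ_s f(s)`), and **`sum_offsets_sum_range_runSite`**: the `n` straight contours of `n` bonds issuing from `B^k(y)` in the
  direction `μ` visit the site of `B^k(y)` at `μ`-offset `j` exactly `j+1` times and the site of `B^k(y+e_μ)` at `μ`-offset `j` exactly `n−1−j` times.
* §3 **`lineAvg_eq_two_blocks`** (`M_k` in block coordinates = tent weights on the two blocks `B^k(y)`, `B^k(y+e_μ)`); `adjField_fibreSite` (the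
  tent-interpolation field `A_W(b) = (L^{kd}L^k)⁻¹((s_b+1)W(ȳ_b) + (L^k−1−s_b)W(ȳ_b − e_μ))` read on a block); **`lineAvg_adjField`**:
  `M_k A_W (c) = (L^{kd}L^k)⁻²(L^k)^{d−1}(α W(c) + γ W(c−e_μ) + γ W(c+e_μ))` with the tent moments `α = Σ_{s<n}((s+1)² + (n−1−s)²)`,
  `γ = Σ_{s<n}(s+1)(n−1−s)` — the normal operator is a B-spline convolution along the bond's own axis and the identity transversally.

WHAT THIS IS NOT.  Not print's `G`-weighted `H` (no Landau condition `RD^*HB = 0` is imposed on the interpolant), not the right inverse of the TRUE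
linearised (0.4)-averaging (main term ∘ block-axial representative + comb terms, `BlockAveragingEMLLinearised`), not the nonlinear chart; nothing of
Bałaban's is asserted.

References: T. Bałaban, CMP 102 (1985) 277–309 [Balaban1985Variational] ((45)–(47) p.285, p.287); CMP 95 (1984) 17–40 [Balaban1984PropagatorsI]
((1.18) p.20).
-/

noncomputable section

open scoped BigOperators

namespace Summit.QuantumFields.YangMills.Theorems.Prop7LineAvgRightInverse

open Literature.MathematicalPhysics.QuantumFieldTheory.Balaban1983to89
open Finset LatticeFieldCalculus B1RG242Torus
open B10StarCount (sum_pbond)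
open Summit.QuantumFields.YangMills.Theorems.Prop7FlatCoercivity (iterate_shift_eq_runSite runSite_runSite runSite_apply_self
  runSite_apply_of_ne fibreSite_runSite sum_fibre_eq_sum_offsets)

variable {P : Params} {k : ℕ}

/-! ## §1 Two triangular counting identities on `ℕ` -/

/-- Lower triangle: `Σ_{s<n} Σ_{t<n−s} g(s+t) = Σ_{j<n} (j+1)•g(j)` (each `j < n` is hit by the `j+1` pairs `s + t = j`). [folklore] -/
theorem sum_sum_lt_sub_eq {M : Type*} [AddCommMonoid M] (g : ℕ → M) (n : ℕ) :
    ∑ s ∈ range n, ∑ t ∈ range (n - s), g (s + t) = ∑ j ∈ range n, (j + 1) • g j := by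
  induction n with
  | zero => simp
  | succ n ih =>
    rw [Finset.sum_range_succ, Nat.add_sub_cancel_left, Finset.sum_range_one, Nat.add_zero, Finset.sum_range_succ, ← ih]
    have hstep : ∀ s ∈ range n, ∑ t ∈ range (n + 1 - s), g (s + t) = ∑ t ∈ range (n - s), g (s + t) + g n := by
      intro s hs
      have hs' : s < n := Finset.mem_range.mp hs
      rw [show n + 1 - s = (n - s) + 1 by omega, Finset.sum_range_succ, show s + (n - s) = n by omega]
    rw [Finset.sum_congr rfl hstep, Finset.sum_add_distrib, Finset.sum_const, Finset.card_range, succ_nsmul, add_assoc]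
    rfl

/-- Upper triangle: `Σ_{s<n} Σ_{i<s} f(i) = Σ_{i<n} (n−1−i)•f(i)`. [folklore] -/
theorem sum_sum_lt_eq {M : Type*} [AddCommMonoid M] (f : ℕ → M) (n : ℕ) :
    ∑ s ∈ range n, ∑ i ∈ range s, f i = ∑ i ∈ range n, (n - 1 - i) • f i := by
  induction n with
  | zero => simp
  | succ n ih =>
    rw [Finset.sum_range_succ, ih, Finset.sum_range_succ, show n + 1 - 1 - n = 0 by omega, zero_smul, add_zero,
      ← Finset.sum_add_distrib]
    refine Finset.sum_congr rfl fun i hi => ?_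
    have hi' : i < n := Finset.mem_range.mp hi
    rw [show n + 1 - 1 - i = (n - 1 - i) + 1 by omega, succ_nsmul]

/-- **The two-block count of a straight contour**: `Σ_{s<n} Σ_{t<n} g(s+t) = Σ_{j<n} (j+1)•g(j) + Σ_{j<n} (n−1−j)•g(n+j)` — a fine site at
offset `j` of the starting block lies on `j + 1` of the `n` contours of length `n` issuing from the block, a site at offset `j` of the next block
on `n − 1 − j` of them. [folklore] -/
theorem sum_sum_range_add_eq {M : Type*} [AddCommMonoid M] (g : ℕ → M) (n : ℕ) :
    ∑ s ∈ range n, ∑ t ∈ range n, g (s + t) = ∑ j ∈ range n, (j + 1) • g j + ∑ j ∈ range n, (n - 1 - j) • g (n + j) := by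
  have hsplit : ∀ s ∈ range n, ∑ t ∈ range n, g (s + t) = ∑ t ∈ range (n - s), g (s + t) + ∑ i ∈ range s, g (n + i) := by
    intro s hs
    have hs' : s < n := Finset.mem_range.mp hs
    rw [← Finset.sum_range_add_sum_Ico _ (show n - s ≤ n by omega), Finset.sum_Ico_eq_sum_range,
      show n - (n - s) = s by omega]
    congr 1
    refine Finset.sum_congr rfl fun i _ => ?_
    rw [show s + (n - s + i) = n + i by omega]
  rw [Finset.sum_congr rfl hsplit, Finset.sum_add_distrib, sum_sum_lt_sub_eq, sum_sum_lt_eq]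

/-! ## §2 Offsets inside a `k`-block: singling out one direction -/

section Offsets

variable (μ : Fin P.d)

/-- The zero offset. [folklore] -/
private theorem npos : 0 < P.L ^ k := pow_pos P.L_pos k

/-- Sums over offset vectors `r ∈ {0,…,L^k−1}^d` as iterated sums over the vector with `μ`-component reset to `0` and the `μ`-component
(the map `(r₀, s) ↦ r₀[μ ↦ s]` is a bijection). [folklore] -/
theorem sum_offsets_eq_sum_split {M : Type*} [AddCommMonoid M] (Φ : (Fin P.d → Fin (P.L ^ k)) → M) :
    ∑ r : Fin P.d → Fin (P.L ^ k), Φ r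
      = ∑ r₀ : {r : Fin P.d → Fin (P.L ^ k) // r μ = ⟨0, npos⟩}, ∑ s : Fin (P.L ^ k), Φ (Function.update r₀.1 μ s) := by
  let e : ({r : Fin P.d → Fin (P.L ^ k) // r μ = ⟨0, npos⟩} × Fin (P.L ^ k)) ≃ (Fin P.d → Fin (P.L ^ k)) :=
    { toFun := fun p => Function.update p.1.1 μ p.2
      invFun := fun r => (⟨Function.update r μ ⟨0, npos⟩, Function.update_self _ _ _⟩, r μ)
      left_inv := fun p => by
        obtain ⟨⟨r, hr⟩, s⟩ := p
        ext ν
        · simp only [Function.update_idem]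
          rw [← hr, Function.update_eq_self]
        · simp
      right_inv := fun r => by
        simp only [Function.update_idem]
        exact Function.update_eq_self μ r }
  rw [← Fintype.sum_prod_type', ← e.sum_comp]
  rfl

/-- The number of offset vectors with `μ`-component `0` is `(L^k)^{d−1}`. [folklore] -/
theorem card_offsets_reset : Fintype.card {r : Fin P.d → Fin (P.L ^ k) // r μ = ⟨0, npos⟩} = (P.L ^ k) ^ (P.d - 1) := by
  have hc := sum_offsets_eq_sum_split (P := P) (k := k) μ (fun _ => (1 : ℕ))
  simp only [Finset.sum_const, Finset.card_univ, Fintype.card_fun, Fintype.card_fin, smul_eq_mul, mul_one] at hc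
  have hpow : (P.L ^ k) ^ P.d = (P.L ^ k) ^ (P.d - 1) * P.L ^ k := by
    rw [← pow_succ]; congr 1; have := P.hd; omega
  rw [hpow] at hc
  exact (mul_right_cancel₀ (npos (P := P) (k := k)).ne' hc).symm

/-- Summing a function of the `μ`-offset over all offset vectors: `Σ_r f(r_μ) = (L^k)^{d−1}·Σ_s f(s)`. [folklore] -/
theorem sum_offsets_comp_eval (f : Fin (P.L ^ k) → ℝ) :
    ∑ r : Fin P.d → Fin (P.L ^ k), f (r μ) = ((P.L ^ k : ℕ) : ℝ) ^ (P.d - 1) * ∑ s : Fin (P.L ^ k), f s := by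
  rw [sum_offsets_eq_sum_split μ]
  simp only [Function.update_self, Finset.sum_const, Finset.card_univ, card_offsets_reset, nsmul_eq_mul, Nat.cast_pow]

/-- Changing the `μ`-offset from `0` to `s` is running `s` unit steps in the direction `μ`. [folklore] -/
theorem fibreSite_update (y : Site P k) (r : Fin P.d → Fin (P.L ^ k)) (hr : r μ = ⟨0, npos⟩) (s : Fin (P.L ^ k)) :
    Site.fibreSite 0 k y (Function.update r μ s) = runSite (Site.fibreSite 0 k y r) μ s := by
  funext ν
  by_cases hν : ν = μ
  · subst hν
    rw [runSite_apply_self]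
    simp only [Site.fibreSite, Function.update_self, hr]
    push_cast
    ring
  · rw [runSite_apply_of_ne _ hν]
    simp only [Site.fibreSite, Function.update_of_ne hν]

/-- One coarse step forward then backward. [folklore] -/
theorem unshift_runSite_one (y : Site P k) : (runSite y μ 1).unshift μ = y := by
  rw [show (1 : ℕ) = 0 + 1 from rfl, runSite_succ, runSite_zero, B10StarCount.unshift_shift]

variable (h : P.sitesPerDir 0 = P.L ^ k * P.sitesPerDir k)
include h

/-- The `μ`-offset of a fine site written in block coordinates. [folklore] -/
theorem val_fibreSite_mod (y : Site P k) (r : Fin P.d → Fin (P.L ^ k)) :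
    ((Site.fibreSite 0 k y r) μ).val % P.L ^ k = r μ := by
  rw [Site.val_fibreSite h, Nat.mul_add_mod', Nat.mod_eq_of_lt (r μ).isLt]

/-- **THE WEIGHTS OF THE STRAIGHT-LINE BLOCK AVERAGE** (the `n = L^k` straight contours of `n` bonds issuing from the block `B^k(y)` in the
direction `μ`, [Balaban1984PropagatorsI] (1.18) «(Q_kA)_b = Σ_{x∈B^k(b₋)} η^{d+1} A([x, x(b)])», visit a fine site of `B^k(y)` at `μ`-offset `j`
exactly `j + 1` times and a fine site of `B^k(y + e_μ)` at `μ`-offset `j` exactly `n − 1 − j` times): for every `G`,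
`Σ_{r} Σ_{t<n} G(x_r + t e_μ) = Σ_r (r_μ + 1)•G(x_r) + Σ_r (n − 1 − r_μ)•G(x′_r)`, `x_r` / `x′_r` the sites of offset `r` in `B^k(y)` / `B^k(y+e_μ)`.
[cite: Balaban1984PropagatorsI, (1.18) p.20] -/
theorem sum_offsets_sum_range_runSite {M : Type*} [AddCommMonoid M] (y : Site P k) (G : Site P 0 → M) :
    ∑ r : Fin P.d → Fin (P.L ^ k), ∑ t ∈ range (P.L ^ k), G (runSite (Site.fibreSite 0 k y r) μ t)
      = ∑ r : Fin P.d → Fin (P.L ^ k), ((r μ : ℕ) + 1) • G (Site.fibreSite 0 k y r)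
        + ∑ r : Fin P.d → Fin (P.L ^ k), (P.L ^ k - 1 - (r μ : ℕ)) • G (Site.fibreSite 0 k (runSite y μ 1) r) := by
  rw [sum_offsets_eq_sum_split μ, sum_offsets_eq_sum_split μ (fun r => ((r μ : ℕ) + 1) • G (Site.fibreSite 0 k y r)),
    sum_offsets_eq_sum_split μ (fun r => (P.L ^ k - 1 - (r μ : ℕ)) • G (Site.fibreSite 0 k (runSite y μ 1) r)),
    ← Finset.sum_add_distrib]
  refine Finset.sum_congr rfl fun r₀ _ => ?_
  obtain ⟨r₀, hr₀⟩ := r₀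
  -- everything along the line through the base site of offset `r₀`
  have hbase : ∀ s : Fin (P.L ^ k), Site.fibreSite 0 k y (Function.update r₀ μ s) = runSite (Site.fibreSite 0 k y r₀) μ s :=
    fun s => fibreSite_update μ y r₀ hr₀ s
  have hnext : ∀ s : Fin (P.L ^ k), Site.fibreSite 0 k (runSite y μ 1) (Function.update r₀ μ s)
      = runSite (Site.fibreSite 0 k y r₀) μ (P.L ^ k + s) := fun s => by
    rw [fibreSite_runSite h y μ 1, hbase s, runSite_runSite, one_mul, add_comm]
  simp only [Function.update_self, hbase, hnext, runSite_runSite]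
  have h1 := sum_sum_range_add_eq (fun j => G (runSite (Site.fibreSite 0 k y r₀) μ j)) (P.L ^ k)
  simp only [Finset.sum_range] at h1 ⊢
  exact h1

end Offsets

/-! ## §3 The straight-line block average on two blocks, its transpose-type field, and the tridiagonal normal operator -/

section Normal

variable (h : P.sitesPerDir 0 = P.L ^ k * P.sitesPerDir k)
include h

/-- **THE STRAIGHT-LINE `k`-FOLD BLOCK AVERAGE IN BLOCK COORDINATES** (the average of record `(M_kX)(⟨y, μ⟩) = (L^{kd}L^k)⁻¹ Σ_{x∈B^k(y)}
Σ_{t<L^k} X(⟨x + te_μ, μ⟩)` = `LatticeFieldCalculus.bondAvgIter k` by `Prop7FlatCoercivity.bondAvgIter_eq_lineBlockAvg`): it weighs the bond at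
`μ`-offset `s` of `B^k(y)` by `s + 1` and the bond at `μ`-offset `s` of `B^k(y + e_μ)` by `L^k − 1 − s` (tent weights).
[cite: Balaban1984PropagatorsI, (1.18) p.20] -/
theorem lineAvg_eq_two_blocks (X : PBond P 0 → ℝ) (c : PBond P k) :
    (((P.L : ℝ) ^ k) ^ P.d * (P.L : ℝ) ^ k)⁻¹ *
        ∑ x ∈ univ.filter (fun x : Site P 0 => Site.proj k k x = c.src), ∑ t ∈ range (P.L ^ k), X ⟨(fun z : Site P 0 => z.shift c.dir)^[t] x, c.dir⟩
      = (((P.L : ℝ) ^ k) ^ P.d * (P.L : ℝ) ^ k)⁻¹ *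
        (∑ r : Fin P.d → Fin (P.L ^ k), (((r c.dir : ℕ) : ℝ) + 1) * X ⟨Site.fibreSite 0 k c.src r, c.dir⟩
          + ∑ r : Fin P.d → Fin (P.L ^ k), ((P.L ^ k - 1 - (r c.dir : ℕ) : ℕ) : ℝ) * X ⟨Site.fibreSite 0 k (runSite c.src c.dir 1) r, c.dir⟩) := by
  congr 1
  rw [sum_fibre_eq_sum_offsets h]
  simp only [iterate_shift_eq_runSite]
  rw [sum_offsets_sum_range_runSite c.dir h c.src (fun z => X ⟨z, c.dir⟩)]
  simp only [nsmul_eq_mul]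
  push_cast
  rfl

/-- The transpose-type field `A` of a coarse bond field `W` (tent interpolation between `W(y − e_μ)` and `W(y)` along each block:
`A(b) = (L^{kd}L^k)⁻¹((s_b+1)·W(⟨ȳ_b, μ⟩) + (L^k − 1 − s_b)·W(⟨ȳ_b − e_μ, μ⟩))`, `ȳ_b` the block of `b₋`, `s_b` its `μ`-offset), read on the
block `B^k(y)`. [folklore] -/
theorem adjField_fibreSite (W : PBond P k → ℝ) (A : PBond P 0 → ℝ)
    (hA : ∀ b : PBond P 0, A b = (((P.L : ℝ) ^ k) ^ P.d * (P.L : ℝ) ^ k)⁻¹ *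
        (((((b.src b.dir).val % P.L ^ k : ℕ) : ℝ) + 1) * W ⟨Site.proj k k b.src, b.dir⟩
          + ((P.L ^ k - 1 - (b.src b.dir).val % P.L ^ k : ℕ) : ℝ) * W ⟨(Site.proj k k b.src).unshift b.dir, b.dir⟩))
    (y : Site P k) (μ : Fin P.d) (r : Fin P.d → Fin (P.L ^ k)) :
    A ⟨Site.fibreSite 0 k y r, μ⟩
      = (((P.L : ℝ) ^ k) ^ P.d * (P.L : ℝ) ^ k)⁻¹ *
        ((((r μ : ℕ) : ℝ) + 1) * W ⟨y, μ⟩ + ((P.L ^ k - 1 - (r μ : ℕ) : ℕ) : ℝ) * W ⟨y.unshift μ, μ⟩) := by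
  rw [hA]
  simp only [val_fibreSite_mod μ h, Site.proj_fibreSite h]

omit h in
/-- Finite-sum algebra: collecting the tent weights into the three coefficients of the normal operator. [folklore] -/
theorem sum_tent_collect {ι : Type*} (S : Finset ι) (a b : ι → ℝ) (C W₁ W₂ W₃ : ℝ) :
    ∑ s ∈ S, a s * (C * (a s * W₁ + b s * W₂)) + ∑ s ∈ S, b s * (C * (a s * W₃ + b s * W₁))
      = C * ((∑ s ∈ S, (a s ^ 2 + b s ^ 2)) * W₁ + (∑ s ∈ S, a s * b s) * W₂ + (∑ s ∈ S, a s * b s) * W₃) := by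
  simp only [Finset.sum_mul, Finset.mul_sum, mul_add, ← Finset.sum_add_distrib]
  exact Finset.sum_congr rfl fun s _ => by ring

/-- **THE NORMAL OPERATOR OF THE STRAIGHT-LINE AVERAGE IS TRIDIAGONAL ALONG EACH AXIS**: `M_k` applied to the transpose-type field `A` of `W`
is `(L^{kd}L^k)⁻²·(L^k)^{d−1}·(α·W(c) + γ·W(c − e_μ) + γ·W(c + e_μ))` at `c = ⟨y, μ⟩`, with the tent moments `α = Σ_{s<L^k}((s+1)² + (L^k−1−s)²)`,
`γ = Σ_{s<L^k}(s+1)(L^k−1−s)` (a discrete B-spline convolution in the direction `μ`, the identity transversally). [folklore] -/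
theorem lineAvg_adjField (W : PBond P k → ℝ) (A : PBond P 0 → ℝ)
    (hA : ∀ b : PBond P 0, A b = (((P.L : ℝ) ^ k) ^ P.d * (P.L : ℝ) ^ k)⁻¹ *
        (((((b.src b.dir).val % P.L ^ k : ℕ) : ℝ) + 1) * W ⟨Site.proj k k b.src, b.dir⟩
          + ((P.L ^ k - 1 - (b.src b.dir).val % P.L ^ k : ℕ) : ℝ) * W ⟨(Site.proj k k b.src).unshift b.dir, b.dir⟩))
    (c : PBond P k) :
    (((P.L : ℝ) ^ k) ^ P.d * (P.L : ℝ) ^ k)⁻¹ *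
        ∑ x ∈ univ.filter (fun x : Site P 0 => Site.proj k k x = c.src), ∑ t ∈ range (P.L ^ k), A ⟨(fun z : Site P 0 => z.shift c.dir)^[t] x, c.dir⟩
      = (((P.L : ℝ) ^ k) ^ P.d * (P.L : ℝ) ^ k)⁻¹ * ((((P.L ^ k : ℕ) : ℝ) ^ (P.d - 1)) *
          ((((P.L : ℝ) ^ k) ^ P.d * (P.L : ℝ) ^ k)⁻¹ *
            ((∑ s : Fin (P.L ^ k), ((((s : ℕ) : ℝ) + 1) ^ 2 + (((P.L ^ k - 1 - (s : ℕ) : ℕ) : ℝ)) ^ 2)) * W c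
              + (∑ s : Fin (P.L ^ k), (((s : ℕ) : ℝ) + 1) * ((P.L ^ k - 1 - (s : ℕ) : ℕ) : ℝ)) * W ⟨c.src.unshift c.dir, c.dir⟩
              + (∑ s : Fin (P.L ^ k), (((s : ℕ) : ℝ) + 1) * ((P.L ^ k - 1 - (s : ℕ) : ℕ) : ℝ)) * W ⟨runSite c.src c.dir 1, c.dir⟩))) := by
  rw [lineAvg_eq_two_blocks h A c]
  congr 1
  simp only [adjField_fibreSite h W A hA, unshift_runSite_one]
  have e1 : ∑ r : Fin P.d → Fin (P.L ^ k), (((r c.dir : ℕ) : ℝ) + 1) * ((((P.L : ℝ) ^ k) ^ P.d * (P.L : ℝ) ^ k)⁻¹ *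
        ((((r c.dir : ℕ) : ℝ) + 1) * W ⟨c.src, c.dir⟩ + ((P.L ^ k - 1 - (r c.dir : ℕ) : ℕ) : ℝ) * W ⟨c.src.unshift c.dir, c.dir⟩))
      = (((P.L ^ k : ℕ) : ℝ) ^ (P.d - 1)) * ∑ s : Fin (P.L ^ k), (((s : ℕ) : ℝ) + 1) * ((((P.L : ℝ) ^ k) ^ P.d * (P.L : ℝ) ^ k)⁻¹ *
        ((((s : ℕ) : ℝ) + 1) * W ⟨c.src, c.dir⟩ + ((P.L ^ k - 1 - (s : ℕ) : ℕ) : ℝ) * W ⟨c.src.unshift c.dir, c.dir⟩)) :=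
    sum_offsets_comp_eval c.dir (fun s : Fin (P.L ^ k) => (((s : ℕ) : ℝ) + 1) * ((((P.L : ℝ) ^ k) ^ P.d * (P.L : ℝ) ^ k)⁻¹ *
        ((((s : ℕ) : ℝ) + 1) * W ⟨c.src, c.dir⟩ + ((P.L ^ k - 1 - (s : ℕ) : ℕ) : ℝ) * W ⟨c.src.unshift c.dir, c.dir⟩)))
  have e2 : ∑ r : Fin P.d → Fin (P.L ^ k), ((P.L ^ k - 1 - (r c.dir : ℕ) : ℕ) : ℝ) * ((((P.L : ℝ) ^ k) ^ P.d * (P.L : ℝ) ^ k)⁻¹ *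
        ((((r c.dir : ℕ) : ℝ) + 1) * W ⟨runSite c.src c.dir 1, c.dir⟩ + ((P.L ^ k - 1 - (r c.dir : ℕ) : ℕ) : ℝ) * W ⟨c.src, c.dir⟩))
      = (((P.L ^ k : ℕ) : ℝ) ^ (P.d - 1)) * ∑ s : Fin (P.L ^ k), ((P.L ^ k - 1 - (s : ℕ) : ℕ) : ℝ) * ((((P.L : ℝ) ^ k) ^ P.d * (P.L : ℝ) ^ k)⁻¹ *
        ((((s : ℕ) : ℝ) + 1) * W ⟨runSite c.src c.dir 1, c.dir⟩ + ((P.L ^ k - 1 - (s : ℕ) : ℕ) : ℝ) * W ⟨c.src, c.dir⟩)) :=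
    sum_offsets_comp_eval c.dir (fun s : Fin (P.L ^ k) => ((P.L ^ k - 1 - (s : ℕ) : ℕ) : ℝ) * ((((P.L : ℝ) ^ k) ^ P.d * (P.L : ℝ) ^ k)⁻¹ *
        ((((s : ℕ) : ℝ) + 1) * W ⟨runSite c.src c.dir 1, c.dir⟩ + ((P.L ^ k - 1 - (s : ℕ) : ℕ) : ℝ) * W ⟨c.src, c.dir⟩)))
  have hc : (⟨c.src, c.dir⟩ : PBond P k) = c := rfl
  rw [hc] at e1 e2
  rw [e1, e2, ← mul_add, sum_tent_collect]

end Normal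

end Summit.QuantumFields.YangMills.Theorems.Prop7LineAvgRightInverse

end
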